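import Summits.PneNP.PneNP.Theorems.ChebyshevTracialDesignAPrioriBounds
import Summits.PneNP.PneNP.Theorems.ChebyshevTracialDesignBoundedDimension
import Summits.PneNP.PneNP.Theorems.ChebyshevTracialDesignDimensionOne
import Summits.PneNP.PneNP.Theorems.ChebyshevTracialDesignUnconditionalRungs
import HarnessLib

/-!
# Cell pnp-psdrank, route `ChebyshevTracialDesign`: BINNING IN THE FREE WORLD — the tightness-free value of ANY contraction pair is at most
# (number of matching-side bins) × (the rectangle bound) + (variation) × (bin radius); the dimension budget of the crux `TracialDecayExp20`
# (stmt-PneNP-19878) is EXACTLY the covering number of the matching-side operator field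

Brick 85 (prover g15; MEMO-18 §2(c)). In the tightness-free form of the crux (brick 84, `…TightnessFree.tracialDecayExp20_iff_contractions`)
perturbation arguments are legal, because the `r = 1` input — rectangle decay for ALL rectangles, `…UnconditionalRungs.rectangleDecayExp_all_holds`
(NTF, unconditional since brick 81) — no longer asks for tight-freeness. The simplest one: BIN THE MATCHING SIDE. Let `X_U` be psd contractions
of dimension `r`, `Y_M` ANY matrices, `b : PM_n → ι` a finite partition with reference contractions `Y^i` such that `−η·I ⪯ Y_M − Y^{b(M)} ⪯ η·I`.
Then (§2, **`free_value_binned_le`**)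

  `Σ_{U,M} W(U,M)·tr(X_U Y_M) ≤ |ι|·r·γ₁ + B_v·η·r`,

where `γ₁` bounds the design weight `W = levelWeight n t C w` (`Σ|w_c| ≤ B_v`) on every 0/1 rectangle: each bin is the `[0,1]`-weighted rectangle
`(tr(X_U Y^i)/r) × 1[b(M) = i]`, worth `≤ r·γ₁` by the rounding lemma (`…DimensionOne.sum_box_le_rectangle`), and the remainder
`tr(X_U (Y_M − Y^{b(M)}))` is `≤ η·tr X_U ≤ η·r` in absolute value (§1), against a weight of total mass `Σ|W| ≤ B_v`. With NTF (`γ₁ = 20·e^{−a·dq n}`,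
§3 **`free_value_binned_le_exp`**) this is UNCONDITIONAL: every contraction pair whose matching side is covered by `N` operator-norm balls of
radius `η` has normalised value `≤ 20·N·e^{−a·dq n} + 20·η` — for tight OR untight pairs, at every dimension. Since `{0 ⪯ Y ⪯ I_r}` has
`η`-covering number `≤ (3/η)^{r²}`, this is the bounded-dimension theorem in the free world (rate `≍ a/r²`, cf. `…BoundedDimension`'s `a/(8(r₀+1))`
for tight pairs via block-lift nets) with a three-line proof, and it localises the crux's difficulty: THE ONLY LOSS IS `N·γ₁` — the rectangle bound is
ABSOLUTE and is paid once per bin. A mass-linear rectangle bound (`≤ γ₁·ν(B)`) would remove the loss at every `r`, and is FALSE (it is virtual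
nonnegativity pointwise in the matching, which fails at `D = 1` already: MEMO-18 §2(c)); so `TracialDecayExp20` is precisely the statement that the
per-bin accounting can be beaten by a factor `e^{Θ(aD·r²)}` for operator fields `M ↦ Y_M` of dimension `r < e^{a·dq n/2}` — an `r`-UNIFORMITY
statement, no fixed-`r` statement being a rung. [cite: Rothvoss2017, §2 (PDF pp. 6–8)] [cite: BrietDadushPokutta2014, Thm. 6 (§3)]
[cite: KeevashLifshitz2023, Thm. 1.8]
Stature: support/instrument (bookkeeping; unconditional). WHAT THIS IS NOT: no `r`-uniform bound, nothing on psd rank of P_PM(K_n), no P-vs-NP content.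
-/

set_option linter.dupNamespace false -- `Summit.PneNP.PneNP.…`: summit = sub-problem (D-0017)

noncomputable section

namespace Summit.PneNP.PneNP.Theorems.ChebyshevTracialDesignFreeBinning

open Finset Matrix Literature.Barriers.PneNP Literature.Combinatorics.Optimization
open Summit.PneNP.PneNP.Theorems.ChebyshevTracialDesignAPrioriBounds
open Summit.PneNP.PneNP.Theorems.ChebyshevTracialDesignBoundedDim
open Summit.PneNP.PneNP.Theorems.ChebyshevTracialDesignDimensionOne
open Summit.PneNP.PneNP.Theorems.ChebyshevTracialDesignUnconditionalRungs

variable {n r : ℕ}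

/-! ### §1 Trace bookkeeping: a psd contraction against an operator-norm-small matrix -/

/-- `tr(X B) ≥ 0` for psd `X`, `B` (via the tree's `HasPsdFactorization.nonneg`). -/
theorem trace_mul_nonneg_of_psd {X B : Matrix (Fin r) (Fin r) ℝ} (hX : X.PosSemidef) (hB : B.PosSemidef) : 0 ≤ (X * B).trace :=
  (show HasPsdFactorization (fun (_ : Unit) (_ : Unit) => (X * B).trace) r from
    ⟨fun _ => X, fun _ => B, fun _ => hX, fun _ => hB, fun _ _ => rfl⟩).nonneg () ()

/-- **Operator-norm remainder.** If `X ⪰ 0` and `−η·I ⪯ E ⪯ η·I` then `|tr(X E)| ≤ η·tr X`. -/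
theorem abs_trace_mul_le {X E : Matrix (Fin r) (Fin r) ℝ} (hX : X.PosSemidef) {η : ℝ}
    (hE : (η • (1 : Matrix (Fin r) (Fin r) ℝ) - E).PosSemidef ∧ (η • (1 : Matrix (Fin r) (Fin r) ℝ) + E).PosSemidef) :
    |(X * E).trace| ≤ η * X.trace := by
  have h1 := trace_mul_nonneg_of_psd hX hE.1
  have h2 := trace_mul_nonneg_of_psd hX hE.2
  rw [Matrix.mul_sub, trace_sub, Matrix.mul_smul, Matrix.mul_one, trace_smul, smul_eq_mul] at h1
  rw [Matrix.mul_add, trace_add, Matrix.mul_smul, Matrix.mul_one, trace_smul, smul_eq_mul] at h2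
  rw [abs_le]
  constructor <;> linarith

/-- A psd contraction paired with a psd contraction has `0 ≤ tr(X Y)/r ≤ 1`. [cite: BrietDadushPokutta2014, Thm. 6 (§3)] -/
theorem trace_div_mem_unitInterval (hr : 0 < r) {X Y : Matrix (Fin r) (Fin r) ℝ} (hX : X.PosSemidef ∧ (1 - X).PosSemidef)
    (hY : Y.PosSemidef ∧ (1 - Y).PosSemidef) : 0 ≤ (X * Y).trace / r ∧ (X * Y).trace / r ≤ 1 := by
  have hr' : (0 : ℝ) < r := by exact_mod_cast hr
  refine ⟨div_nonneg (trace_mul_nonneg_of_psd hX.1 hY.1) hr'.le, ?_⟩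
  rw [div_le_one hr']
  exact (trace_mul_le_trace_left hX.1 hY.2).trans (trace_le_of_sub_posSemidef hX.2)

/-- `|levelWeight| ≤ absWeight` pointwise. -/
theorem abs_levelWeight_le_absWeight (t : ℕ) (C : Finset ℕ) (w : ℕ → ℝ) (U : OddSet n) (M : PMatch n) :
    |levelWeight n t C w U M| ≤ absWeight n t C w U M := by
  unfold levelWeight absWeight
  refine (abs_sum_le_sum_abs _ _).trans (sum_le_sum fun c _ => ?_)
  split_ifs
  · rw [abs_div, Nat.abs_cast]
  · rw [abs_zero]

/-! ### §2 The binned bound -/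

/-- **BINNING IN THE FREE WORLD.** Let `W = levelWeight n t C w` with `Σ|w_c| ≤ B_v`, `X_U` psd contractions of dimension `r ≥ 1`, `Y_M` any
matrices, `b : PM_n → ι` a finite partition of the matchings with reference psd contractions `Y^i` and bin radius `η` in operator norm
(`−η I ⪯ Y_M − Y^{b(M)} ⪯ η I`), and `γ₁` a bound for `W` on every 0/1 rectangle. Then
`Σ_{U,M} W(U,M)·tr(X_U Y_M) ≤ |ι|·r·γ₁ + B_v·η·r` — no tightness anywhere. [cite: Rothvoss2017, §2 (PDF pp. 6–8)]
[cite: BrietDadushPokutta2014, Thm. 6 (§3)] -/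
theorem free_value_binned_le {ι : Type*} [Fintype ι] [DecidableEq ι] {t : ℕ} (hr : 0 < r) (C : Finset ℕ) (w : ℕ → ℝ) {Bv γ₁ η : ℝ}
    (hBv : ∑ c ∈ C, |w c| ≤ Bv)
    {X : OddSet n → Matrix (Fin r) (Fin r) ℝ} (hX : ∀ U, (X U).PosSemidef ∧ (1 - X U).PosSemidef)
    (Y : PMatch n → Matrix (Fin r) (Fin r) ℝ) (b : PMatch n → ι) (Yref : ι → Matrix (Fin r) (Fin r) ℝ)
    (hYref : ∀ i, (Yref i).PosSemidef ∧ (1 - Yref i).PosSemidef)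
    (hη0 : 0 ≤ η) (hη : ∀ M, (η • (1 : Matrix (Fin r) (Fin r) ℝ) - (Y M - Yref (b M))).PosSemidef ∧
      (η • (1 : Matrix (Fin r) (Fin r) ℝ) + (Y M - Yref (b M))).PosSemidef)
    (hrect : ∀ (A : Finset (OddSet n)) (B : Finset (PMatch n)), ∑ U ∈ A, ∑ M ∈ B, levelWeight n t C w U M ≤ γ₁) :
    ∑ U, ∑ M, levelWeight n t C w U M * (X U * Y M).trace ≤ (Fintype.card ι : ℝ) * r * γ₁ + Bv * η * r := by
  classical
  have hr' : (0 : ℝ) < r := by exact_mod_cast hr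
  set W := levelWeight n t C w with hW
  -- split `Y_M = Y^{b(M)} + (Y_M − Y^{b(M)})`
  have hsplit : ∀ U M, W U M * (X U * Y M).trace =
      W U M * (X U * Yref (b M)).trace + W U M * (X U * (Y M - Yref (b M))).trace := fun U M => by
    rw [← mul_add, ← trace_add, ← Matrix.mul_add, add_sub_cancel]
  simp_rw [hsplit, sum_add_distrib]
  refine add_le_add ?_ ?_
  · -- the binned part: one `[0,1]`-weighted rectangle per bin
    have hbin : ∑ U, ∑ M, W U M * (X U * Yref (b M)).trace =
        ∑ i, ∑ U, ∑ M, W U M * ((X U * Yref i).trace * (if b M = i then (1 : ℝ) else 0)) := by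
      have hinner : ∀ U M, W U M * (X U * Yref (b M)).trace =
          ∑ i, W U M * ((X U * Yref i).trace * (if b M = i then (1 : ℝ) else 0)) := fun U M => by
        rw [Fintype.sum_eq_single (b M) (fun i hi => by rw [if_neg (Ne.symm hi), mul_zero, mul_zero]), if_pos rfl, mul_one]
      simp_rw [hinner]
      calc ∑ U, ∑ M, ∑ i, W U M * ((X U * Yref i).trace * (if b M = i then (1 : ℝ) else 0))
          = ∑ U, ∑ i, ∑ M, W U M * ((X U * Yref i).trace * (if b M = i then (1 : ℝ) else 0)) :=
            Finset.sum_congr rfl fun U _ => Finset.sum_comm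
        _ = ∑ i, ∑ U, ∑ M, W U M * ((X U * Yref i).trace * (if b M = i then (1 : ℝ) else 0)) := Finset.sum_comm
    rw [hbin]
    have hone : ∀ i, ∑ U, ∑ M, W U M * ((X U * Yref i).trace * (if b M = i then (1 : ℝ) else 0)) ≤ r * γ₁ := by
      intro i
      have heq : ∑ U, ∑ M, W U M * ((X U * Yref i).trace * (if b M = i then (1 : ℝ) else 0)) =
          r * ∑ U, ∑ M, W U M * ((X U * Yref i).trace / r * (if b M = i then (1 : ℝ) else 0)) := by
        rw [mul_sum]; refine sum_congr rfl fun U _ => ?_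
        rw [mul_sum]; refine sum_congr rfl fun M _ => ?_
        field_simp
      rw [heq]
      refine mul_le_mul_of_nonneg_left ?_ hr'.le
      obtain ⟨A, B, -, hAB⟩ := sum_box_le_rectangle W (fun _ _ => False) (fun U => (X U * Yref i).trace / r)
        (fun M => if b M = i then (1 : ℝ) else 0) (fun U => trace_div_mem_unitInterval hr (hX U) (hYref i))
        (fun M => by split_ifs <;> norm_num) (fun _ _ h => h.elim)
      exact hAB.trans (hrect A B)
    calc ∑ i, ∑ U, ∑ M, W U M * ((X U * Yref i).trace * (if b M = i then (1 : ℝ) else 0))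
        ≤ ∑ _i : ι, (r : ℝ) * γ₁ := sum_le_sum fun i _ => hone i
      _ = (Fintype.card ι : ℝ) * r * γ₁ := by rw [sum_const, card_univ, nsmul_eq_mul]; ring
  · -- the remainder: `|tr(X_U (Y_M − Y^{b(M)}))| ≤ η·tr X_U ≤ η·r` against a weight of total mass `≤ B_v`
    have hterm : ∀ U M, W U M * (X U * (Y M - Yref (b M))).trace ≤ absWeight n t C w U M * (η * r) := by
      intro U M
      have h1 : |(X U * (Y M - Yref (b M))).trace| ≤ η * (X U).trace := abs_trace_mul_le (hX U).1 (hη M)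
      have h2 : (X U).trace ≤ r := trace_le_of_sub_posSemidef (hX U).2
      have h4 : |(X U * (Y M - Yref (b M))).trace| ≤ η * r := h1.trans (mul_le_mul_of_nonneg_left h2 hη0)
      calc W U M * (X U * (Y M - Yref (b M))).trace ≤ |W U M| * |(X U * (Y M - Yref (b M))).trace| := by
            rw [← abs_mul]; exact le_abs_self _
        _ ≤ absWeight n t C w U M * (η * r) :=
            mul_le_mul (abs_levelWeight_le_absWeight t C w U M) h4 (abs_nonneg _)
              ((abs_nonneg _).trans (abs_levelWeight_le_absWeight t C w U M))
    calc ∑ U, ∑ M, W U M * (X U * (Y M - Yref (b M))).trace ≤ ∑ U, ∑ M, absWeight n t C w U M * (η * r) :=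
          sum_le_sum fun U _ => sum_le_sum fun M _ => hterm U M
      _ = (∑ U, ∑ M, absWeight n t C w U M) * (η * r) := by rw [sum_mul]; exact sum_congr rfl fun U _ => by rw [sum_mul]
      _ ≤ (∑ c ∈ C, |w c|) * (η * r) := mul_le_mul_of_nonneg_right (sum_absWeight_le t C w) (mul_nonneg hη0 hr'.le)
      _ ≤ Bv * (η * r) := mul_le_mul_of_nonneg_right hBv (mul_nonneg hη0 hr'.le)
      _ = Bv * η * r := by ring


/-! ### §3 Unconditional form: plug in NTF -/

/-- **FREE BINNED DECAY — UNCONDITIONAL, EVERY DIMENSION.** For some `a > 0` and all large even `n`: for every balanced `B = 20` design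
`(t, C, w)`, EVERY `r ≥ 1` (no budget), every family of psd contractions `X_U` and every family `Y_M` of dimension `r` whose matching side is
covered by finitely many reference psd contractions `Y^i` (`i ∈ ι`) at operator-norm radius `η ≥ 0` along a partition `b`:
`(1/r)·Σ W·tr(X_U Y_M) ≤ 20·|ι|·exp(−a·dq n) + 20·η`. (NTF `rectangleDecayExp_all_holds` fed to `free_value_binned_le`.) With an `η`-net of
`{0 ⪯ Y ⪯ I_r}` (`|ι| ≤ (3/η)^{r²}`) this is tracial decay at every FIXED dimension for untight pairs; the crux `TracialDecayExp20` asks for the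
same with `|ι|·exp(−a·dq n)` replaced by an `r`-uniform quantity. [cite: KeevashLifshitz2023, Thm. 1.8] [cite: Rothvoss2017, §2 (PDF pp. 6–8)]
[cite: BrietDadushPokutta2014, Thm. 6 (§3)] -/
theorem free_value_binned_le_exp :
    ∃ a : ℝ, 0 < a ∧ ∃ n₁ : ℕ, ∀ n : ℕ, n₁ ≤ n → Even n → ∀ (t : ℕ) (C : Finset ℕ) (w : ℕ → ℝ),
      IsBalancedDesign n t (Tq n) (dq n) 20 C w → ∀ r : ℕ, 0 < r →
        ∀ (X : OddSet n → Matrix (Fin r) (Fin r) ℝ) (Y : PMatch n → Matrix (Fin r) (Fin r) ℝ),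
          (∀ U, (X U).PosSemidef ∧ (1 - X U).PosSemidef) →
          ∀ (ι : Type) [Fintype ι] [DecidableEq ι] (b : PMatch n → ι) (Yref : ι → Matrix (Fin r) (Fin r) ℝ),
            (∀ i, (Yref i).PosSemidef ∧ (1 - Yref i).PosSemidef) → ∀ η : ℝ, 0 ≤ η →
            (∀ M, (η • (1 : Matrix (Fin r) (Fin r) ℝ) - (Y M - Yref (b M))).PosSemidef ∧
              (η • (1 : Matrix (Fin r) (Fin r) ℝ) + (Y M - Yref (b M))).PosSemidef) →
            (∑ U, ∑ M, levelWeight n t C w U M * (X U * Y M).trace) / r ≤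
              20 * (Fintype.card ι : ℝ) * Real.exp (-(a * (dq n : ℝ))) + 20 * η := by
  obtain ⟨a, ha, n₁, hNTF⟩ := rectangleDecayExp_all_holds
  refine ⟨a, ha, n₁, fun n hn hev t C w hdes r hr X Y hX ι _ _ b Yref hYref η hη0 hη => ?_⟩
  have hr' : (0 : ℝ) < r := by exact_mod_cast hr
  have hBv : ∑ c ∈ C, |w c| ≤ 20 := hdes.1.2.2.2.2.2.2
  have h := free_value_binned_le hr C w hBv hX Y b Yref hYref hη0 hη (hNTF n hn hev t C w hdes)
  rw [div_le_iff₀ hr']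
  calc ∑ U, ∑ M, levelWeight n t C w U M * (X U * Y M).trace
      ≤ (Fintype.card ι : ℝ) * r * (20 * Real.exp (-(a * (dq n : ℝ)))) + 20 * η * r := h
    _ = (20 * (Fintype.card ι : ℝ) * Real.exp (-(a * (dq n : ℝ))) + 20 * η) * r := by ring

end Summit.PneNP.PneNP.Theorems.ChebyshevTracialDesignFreeBinning

end
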